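import Summits.ResolutionOfSingularities.ResolutionOfSingularities.Theses.WildCones

/-!
# Route `WildCones`, crux `ClassicalRegimes` (stmt-ResolutionOfSingularities-16884) — the point-blow-up
# dynamics NAMED, the order predicates of line `milnor-descent`, and the crux re-pointed

The route items of `Theses/WildCones.lean` (`IsolatedForcedTermination`, `NarrowRunsDie`, `ConeExit`,
`ClassicalRegimes`) share one `let`-bound coefficient calculus (the same as route `FrobeniusClosing`'s).
This file gives every `let` of the crux `ClassicalRegimes` a name — `clean`, `bl`, `ord`, `dv`, `tr`,
`step`, `run`, `ser`, `pd`, `jac`, `Isol`, `MultP` (bodies VERBATIM, so that the crux unfolds to them by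
`Iff.rfl`: `classicalRegimes_iff`) — and adds what line `milnor-descent`
(`Cruxes/ClassicalRegimes/Lines/milnor_descent.lean`, lead's reshape 2026-08-17) cuts through:
`mu` (the Milnor-type colength), `OrdP` (verbatim `ConeExit`'s `let OrdP`), `OrdPSucc`, `InfRun`,
`MuDrop`. They live under `Theorems/` so that the stub files `Theorems/WildConesClassicalRegimesStub….lean`
and the assembly `Theorems/WildConesClassicalRegimes.lean` can import them — the same arrangement as
`Theorems/FrobeniusClosingDefs.lean` (which names the identical calculus for route `FrobeniusClosing`
under namespace `…Theorems.FrobeniusClosing`; it is deliberately NOT imported here: it imports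
`Theses/FrobeniusClosing.lean`, and a `WildCones` proof file has no business depending on, and being
rebuilt with, another route's thesis file; the two namings agree definitionally, body by body).

States are coefficient functions `c : (Fin n → ℕ) → κ` of `a = Σ c(A) u^A ∈ κ[[u₁,…,uₙ]]`, the atom
being the hypersurface `z^p = a` over a perfect field `κ` of characteristic `p`; a move blows up the
closed point, passes to chart `u_i` (total transform divided by `u_i^p`), translates to the point
`u_j = τ_j` of the exceptional divisor and deletes `p`-th-power monomials.

No theorem with content is proved here: definitions and one `Iff.rfl` bridge.
-/

noncomputable section

-- single-problem summit: the doubled namespace component `ResolutionOfSingularities` is forced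
set_option linter.dupNamespace false

open scoped BigOperators Classical

open Summit.ResolutionOfSingularities.ResolutionOfSingularities.Theses.WildCones (ClassicalRegimes)

namespace Summit.ResolutionOfSingularities.ResolutionOfSingularities.Theorems.WildCones

/-! ## The point-blow-up dynamics of the route, named (verbatim the crux's `let`s) -/

/-- Cleaning: delete the `p`-th-power monomials (a `z`-shift over a perfect field). [folklore] -/
def clean (p n : ℕ) (κ : Type) [Field κ] : ((Fin n → ℕ) → κ) → ((Fin n → ℕ) → κ) :=
  fun c A => @ite κ (∀ j, p ∣ A j) (Classical.dec _) 0 (c A)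

/-- Point blow-up, chart `u_i` (`u_j = u_i u_j'`). [folklore] -/
def bl (n : ℕ) (κ : Type) [Field κ] : Fin n → ((Fin n → ℕ) → κ) → ((Fin n → ℕ) → κ) :=
  fun i c B => @ite κ (Finset.sum (Finset.univ.erase i) (fun j => B j) ≤ B i) (Classical.dec _)
    (c (Function.update B i (B i - Finset.sum (Finset.univ.erase i) (fun j => B j)))) 0

/-- Order of a coefficient function (`0` for the zero function). [folklore] -/
def ord (n : ℕ) (κ : Type) [Field κ] : ((Fin n → ℕ) → κ) → ℕ :=
  fun c => sInf {m : ℕ | ∃ A, c A ≠ 0 ∧ m = Finset.sum Finset.univ (fun j => A j)}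

/-- Division by `u_i^s`. [folklore] -/
def dv (n : ℕ) (κ : Type) [Field κ] : Fin n → ℕ → ((Fin n → ℕ) → κ) → ((Fin n → ℕ) → κ) :=
  fun i s c B => c (Function.update B i (B i + s))

/-- Translation `u_j ↦ u_j + τ_j` (`j ≠ i`) on the exceptional divisor `u_i = 0`. [folklore] -/
def tr (n : ℕ) (κ : Type) [Field κ] :
    Fin n → (Fin n → κ) → ℕ → ((Fin n → ℕ) → κ) → ((Fin n → ℕ) → κ) :=
  fun i τ s c B => Finset.sum (Fintype.piFinset (fun _ : Fin n => Finset.range (B i + s + 1)))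
    (fun D => @ite κ (D i = 0) (Classical.dec _) (c (B + D) * Finset.prod (Finset.univ.erase i)
      (fun j => ((Nat.choose (B j + D j) (B j) : ℕ) : κ) * τ j ^ (D j))) 0)

/-- One step of the dynamics: clean, blow up in chart `i`, divide by `u_i^p` (if the cleaned order
is `≥ p`), translate to `τ`, clean. [folklore] -/
def step (p n : ℕ) (κ : Type) [Field κ] :
    Fin n → (Fin n → κ) → ((Fin n → ℕ) → κ) → ((Fin n → ℕ) → κ) :=
  fun i τ c => clean p n κ (tr n κ i τ (@ite ℕ (p ≤ ord n κ (clean p n κ c)) (Classical.dec _) p 0)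
    (dv n κ i (@ite ℕ (p ≤ ord n κ (clean p n κ c)) (Classical.dec _) p 0) (bl n κ i (clean p n κ c))))

/-- The run from `c₀` along the chart word `i` and the translation word `t`. [folklore] -/
def run (p n : ℕ) (κ : Type) [Field κ] :
    ((Fin n → ℕ) → κ) → (ℕ → Fin n) → (ℕ → Fin n → κ) → ℕ → ((Fin n → ℕ) → κ) :=
  fun c₀ i t m => @Nat.rec (fun _ => (Fin n → ℕ) → κ) c₀ (fun m c => step p n κ (i m) (t m) c) m

/-- The cleaned state as a formal power series. [folklore] -/
def ser (p n : ℕ) (κ : Type) [Field κ] : ((Fin n → ℕ) → κ) → MvPowerSeries (Fin n) κ :=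
  fun c => show MvPowerSeries (Fin n) κ from fun A : Fin n →₀ ℕ => clean p n κ c ⇑A

/-- Formal partial derivative `∂/∂u_i`. [folklore] -/
def pd (n : ℕ) (κ : Type) [Field κ] : Fin n → MvPowerSeries (Fin n) κ → MvPowerSeries (Fin n) κ :=
  fun i f => show MvPowerSeries (Fin n) κ from
    fun A : Fin n →₀ ℕ => ((A i + 1 : ℕ) : κ) * f (A + Finsupp.single i 1)

/-- The gradient (Jacobian) ideal `(∂₁a, …, ∂ₙa)` of the cleaned state. [folklore] -/
def jac (p n : ℕ) (κ : Type) [Field κ] : ((Fin n → ℕ) → κ) → Ideal (MvPowerSeries (Fin n) κ) :=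
  fun c => Ideal.span (Set.range (fun i => pd n κ i (ser p n κ c)))

/-- `Isol c`: the Milnor algebra `κ[[u]]/(∂a)` is finite over `κ` (isolated singularity of
`z^p + a`). [folklore] -/
def Isol (p n : ℕ) (κ : Type) [Field κ] : ((Fin n → ℕ) → κ) → Prop :=
  fun c => Module.Finite κ (MvPowerSeries (Fin n) κ ⧸ jac p n κ c)

/-- `MultP c`: the cleaned state is non-zero of order `≥ p` (multiplicity `p`). [folklore] -/
def MultP (p n : ℕ) (κ : Type) [Field κ] : ((Fin n → ℕ) → κ) → Prop :=
  fun c => (∃ A, clean p n κ c A ≠ 0) ∧ ∀ A, clean p n κ c A ≠ 0 → p ≤ Finset.sum Finset.univ (fun j => A j)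

/-- `OrdP c`: the cleaned state has a monomial of degree exactly `p` (with `MultP`: cleaned order
exactly `p`; its negation under `MultP`: cleaned order `≥ p + 1`). Verbatim `ConeExit`'s `OrdP`.
[folklore] -/
def OrdP (p n : ℕ) (κ : Type) [Field κ] : ((Fin n → ℕ) → κ) → Prop :=
  fun c => ∃ A, clean p n κ c A ≠ 0 ∧ Finset.sum Finset.univ (fun j => A j) = p

/-- `OrdPSucc c`: the cleaned state has a monomial of degree exactly `p + 1` (with `MultP ∧ ¬OrdP`:
cleaned order exactly `p + 1`; `MultP ∧ ¬OrdP ∧ ¬OrdPSucc`: cleaned order `≥ p + 2`). [folklore] -/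
def OrdPSucc (p n : ℕ) (κ : Type) [Field κ] : ((Fin n → ℕ) → κ) → Prop :=
  fun c => ∃ A, clean p n κ c A ≠ 0 ∧ Finset.sum Finset.univ (fun j => A j) = p + 1

/-- The Milnor-type colength `μ(c) = dim_κ κ[[u]]/(∂a)` (verbatim FrobeniusClosing's `mu`; a natural
number, meaningful under `Isol c`). [folklore] -/
def mu (p n : ℕ) (κ : Type) [Field κ] : ((Fin n → ℕ) → κ) → ℕ :=
  fun c => Module.finrank κ (MvPowerSeries (Fin n) κ ⧸ jac p n κ c)

/-- **Infinite isolated multiplicity-`p` run** from `c₀` along `i`, `t`. [folklore] -/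
def InfRun (p n : ℕ) (κ : Type) [Field κ] (c₀ : (Fin n → ℕ) → κ) (i : ℕ → Fin n)
    (t : ℕ → Fin n → κ) : Prop :=
  ∀ m, Isol p n κ (run p n κ c₀ i t m) ∧ MultP p n κ (run p n κ c₀ i t m)

/-- **One-step Milnor drop** in `n` variables, characteristic `p`: whenever a state and its successor
are both isolated of multiplicity `p`, the Milnor number drops (asserted by `stub_muDropCurve` for
`n = 1`). [folklore] -/
def MuDrop (p n : ℕ) (κ : Type) [Field κ] : Prop :=
  ∀ (c : (Fin n → ℕ) → κ) (i : Fin n) (τ : Fin n → κ),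
    Isol p n κ c → MultP p n κ c → Isol p n κ (step p n κ i τ c) → MultP p n κ (step p n κ i τ c) →
      mu p n κ (step p n κ i τ c) < mu p n κ c


/-! ## Re-pointing the crux (definitional) -/

/-- **The crux `ClassicalRegimes`, re-pointed at `InfRun`** — definitional: the defs above ARE the
crux's `let`-values (δζβ-reduction), so the crux reads "no infinite isolated multiplicity-`p` run in
the regimes `n ≤ 2 ∨ p = 2`". [folklore] -/
theorem classicalRegimes_iff :
    ClassicalRegimes ↔
      ∀ p : ℕ, p.Prime → ∀ n : ℕ, 0 < n → (n ≤ 2 ∨ p = 2) → ∀ (κ : Type) [Field κ] [CharP κ p]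
        [PerfectField κ] (c₀ : (Fin n → ℕ) → κ) (i : ℕ → Fin n) (t : ℕ → Fin n → κ),
        ¬ InfRun p n κ c₀ i t :=
  Iff.rfl

end Summit.ResolutionOfSingularities.ResolutionOfSingularities.Theorems.WildCones

end
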